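import Summits.QuantumAdvantage.QuantumAdvantage.Theses.MobiusLadder
import Literature.Computability.Complexity.CircuitClassesProofs
import Literature.Computability.Complexity.TautCertificates
import Literature.NumberTheory.LFunctions.MoebiusWalshCircuitsACdProofs

/-!
# Route `MobiusLadder`, item `LiouvilleNotTC0` (stmt-QuantumAdvantage-1398)

The class glue of the TC⁰ rung of route `QuantumAdvantage/MobiusLadder`:
`LiouvilleOrthogonalTC0 → L_λ ∉ TC0`, where
`L_λ = encodingNatBool.toLanguage {N | λ N = -1}` is the Liouville language (canonical LSB-first
binary numerals, Mathlib `Computability.encodingNatBool`).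

The proof is elementary and uses no prime number theory; it is written for an ARBITRARY gate
basis `B` (`liouvilleLang_not_mem_depthSizeClass`), so the same theorem also yields the AC⁰ glue
`LiouvilleNotAC0` (item stmt-QuantumAdvantage-1396) verbatim.

* Encoding glue (`ofFn_testBit_mem_toLanguage_iff`): for `N < 2^(k+1)` the bit vector
  `(N.testBit i)_{i<k+1}` is (the `List.ofFn` of) a codeword of `encodingNatBool` iff its top bit is
  `1`, i.e. iff `2^k ≤ N`, and then it encodes `N` itself (canonical numerals end in `true`,
  `Literature.Computability.Complexity.IsCanonicalNum`). Hence a family deciding `L_λ`, evaluated at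
  length `k+3` on the digits of `N < 2^(k+3)`, outputs `[2^(k+2) ≤ N ∧ λ N = -1]`
  (`CircuitFamily.Decides.eval_eq` does the dependent-type transport).
* Arithmetic (`abs_sum_liouville_range_le`): `|∑_{N<4J} λ(N)| ≤ 2J`, by complete multiplicativity
  `λ(2m) = -λ(m)` (tree: `Literature.NumberTheory.LFunctions.Green2012.liouville_two_mul`, from
  Mathlib `ArithmeticFunction.liouville_apply_mul`): splitting by parity twice,
  `∑_{N<4J} λ(N) = -∑_{M<J} λ(2M) + ∑_{M<J} λ(2J+2M+1)`.
* Assembly: with `J = 2^k` the correlation sum equals `4J + ∑_{N<4J} λ(N) ≥ 2J`, while the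
  hypothesis with `ε = 1/8` bounds it by `J`; contradiction.

Sources: S. Arora, B. Barak, *Computational Complexity* (2009), §14.4.2 (TC⁰), Def. 6.2 (families
deciding a language); B. Green, Combin. Probab. Comput. 21 (2012), §1 (the `μ`/`λ` versus `AC⁰`
set-up this glue abstracts).
-/

set_option linter.dupNamespace false -- D-0017: single-problem summit ⇒ `QuantumAdvantage.QuantumAdvantage` by design

namespace Summit.QuantumAdvantage.QuantumAdvantage.Theorems.MobiusLadder

open Literature.Computability.Complexity
open Literature.Probability.RandomGraphs.LowDegree (sgn sgn_true sgn_false)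
open _root_.Computability

/-! ### Binary numerals versus bit vectors -/

/-- The bits of `bitsToNat l` are the entries of `l` (reproved here to keep imports light; the
same statement is `Literature.Computability.AlgebraicComplexity.…testBit_bitsToNat`). [folklore] -/
private theorem testBit_bitsToNat (l : List Bool) (t : ℕ) :
    (bitsToNat l).testBit t = l.getD t false := by
  induction l generalizing t with
  | nil => simp
  | cons b l ih =>
    rw [bitsToNat_cons]
    cases t with
    | zero =>
      rw [Nat.testBit_zero]
      cases b <;> simp [Nat.add_mod]
    | succ t =>
      rw [Nat.testBit_add_one, List.getD_cons_succ, ← ih]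
      congr 1
      have hb : b.toNat ≤ 1 := Bool.toNat_le b
      omega

/-- The value of the bit vector of the `n` low binary digits of `N` is `N % 2^n`
(Arora–Barak 2009, §0.1, binary representation). [folklore] -/
theorem bitsToNat_ofFn_testBit (n N : ℕ) :
    bitsToNat (List.ofFn fun i : Fin n => N.testBit i) = N % 2 ^ n := by
  apply Nat.eq_of_testBit_eq
  intro t
  rw [testBit_bitsToNat, Nat.testBit_mod_two_pow, List.getD_eq_getElem?_getD, List.getElem?_ofFn]
  by_cases ht : t < n <;> simp [ht]

/-- An integer in `[2^k, 2^(k+1))` has top binary digit `1` at position `k`. [folklore] -/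
theorem testBit_eq_true_of_two_pow_le {k N : ℕ} (h₁ : 2 ^ k ≤ N) (h₂ : N < 2 ^ (k + 1)) :
    N.testBit k = true := by
  by_contra h
  have h' : N.testBit k = false := by simpa using h
  have hlt : N < 2 ^ k := Nat.lt_pow_two_of_testBit N fun i hi => by
    rcases Nat.eq_or_lt_of_le hi with rfl | hlt
    · exact h'
    · exact Nat.testBit_lt_two_pow
        (h₂.trans_le (Nat.pow_le_pow_right (by norm_num) (Nat.succ_le_of_lt hlt)))
  exact absurd hlt (not_lt.2 h₁)

/-- **Encoding glue.** For `N < 2^(k+1)`, the length-`(k+1)` bit vector of `N` (least significant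
digit first, read with `Nat.testBit`) is a codeword of Mathlib's canonical binary encoding
`encodingNatBool` lying in the language of `S ⊆ ℕ` iff its top digit is `1` (`2^k ≤ N`) and
`N ∈ S`: canonical numerals are exactly the strings that are empty or end in `true`
(`IsCanonicalNum`, `isCanonicalNum_iff`), and a codeword of length `k+1` with value `N` is
`encodeNat N` (`bitsToNat_encodeNat`). (Arora–Barak 2009, §1.2: decision problems as languages of
encodings.) [cite: AroraBarakCC2009, §1.2] -/
theorem ofFn_testBit_mem_toLanguage_iff (S : Set ℕ) {k N : ℕ} (hN : N < 2 ^ (k + 1)) :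
    (List.ofFn fun i : Fin (k + 1) => N.testBit i) ∈ encodingNatBool.toLanguage S ↔
      2 ^ k ≤ N ∧ N ∈ S := by
  set w : List Bool := List.ofFn fun i : Fin (k + 1) => N.testBit i with hw
  have hval : bitsToNat w = N := by
    rw [hw, bitsToNat_ofFn_testBit, Nat.mod_eq_of_lt hN]
  have hlast : w.getLast? = some (N.testBit k) := by
    rw [hw, List.ofFn_succ', List.concat_eq_append, List.getLast?_concat, Fin.val_last]
  have hne : w ≠ [] := by
    rw [hw]
    simp
  have henc : ∀ M : ℕ, encodeNat M = w → M = N := fun M hM => by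
    rw [← bitsToNat_encodeNat M, hM, hval]
  show w ∈ encodingNatBool.encode '' S ↔ _
  rw [Set.mem_image]
  constructor
  · rintro ⟨M, hM, hMw⟩
    have hMw' : encodeNat M = w := hMw
    obtain rfl := henc M hMw'
    refine ⟨?_, hM⟩
    have hcan : IsCanonicalNum w := hMw' ▸ isCanonicalNum_encodeNat M
    rcases hcan with h0 | hl
    · exact absurd h0 hne
    · rw [hlast, Option.some_inj] at hl
      exact Nat.ge_two_pow_of_testBit hl
  · rintro ⟨hk, hS⟩
    have hcan : IsCanonicalNum w :=
      Or.inr (by rw [hlast, testBit_eq_true_of_two_pow_le hk hN])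
    obtain ⟨M, hM⟩ := (isCanonicalNum_iff w).1 hcan
    obtain rfl := henc M hM
    exact ⟨M, hS, hM⟩

/-! ### The Liouville function: values and a cancellation -/

/-- `λ(N) ∈ {1, -1}` for `N ≠ 0` (Mathlib: `λ(N) = (-1)^{Ω(N)}`). [folklore] -/
theorem liouville_eq_one_or_eq_neg_one {N : ℕ} (hN : N ≠ 0) :
    ArithmeticFunction.liouville N = 1 ∨ ArithmeticFunction.liouville N = -1 := by
  rw [ArithmeticFunction.liouville_apply hN]
  exact neg_one_pow_eq_or ℤ _

/-- `|λ(N)| ≤ 1` for every `N` (with `λ(0) = 0`). [folklore] -/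
theorem abs_cast_liouville_le_one (N : ℕ) :
    |((ArithmeticFunction.liouville N : ℤ) : ℝ)| ≤ 1 := by
  rcases eq_or_ne N 0 with rfl | hN
  · simp
  · rcases liouville_eq_one_or_eq_neg_one hN with h | h <;> simp [h]

/-- Splitting a sum over `[0, 2m)` by the parity of the index. [folklore] -/
theorem sum_range_two_mul (f : ℕ → ℝ) (m : ℕ) :
    ∑ N ∈ Finset.range (2 * m), f N = ∑ N ∈ Finset.range m, (f (2 * N) + f (2 * N + 1)) := by
  induction m with
  | zero => simp
  | succ m ih =>
    rw [show 2 * (m + 1) = 2 * m + 1 + 1 by ring, Finset.sum_range_succ, Finset.sum_range_succ, ih,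
      Finset.sum_range_succ]
    ring

/-- **The elementary cancellation** `|∑_{N < 4J} λ(N)| ≤ 2J` (no prime number theorem): the odd
`m < 2J` pair off against `2m < 4J` since `λ(2m) = -λ(m)`; in formulas,
`∑_{N<4J} λ(N) = -∑_{M<J} λ(2M) + ∑_{M<J} λ(2J+2M+1)`, two sums of `J` terms of modulus `≤ 1`.
[folklore] -/
theorem abs_sum_liouville_range_le (J : ℕ) :
    |∑ N ∈ Finset.range (4 * J), ((ArithmeticFunction.liouville N : ℤ) : ℝ)| ≤ 2 * J := by
  have hfb : ∀ N : ℕ, |((ArithmeticFunction.liouville N : ℤ) : ℝ)| ≤ 1 := abs_cast_liouville_le_one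
  have h2 : ∀ N : ℕ, ((ArithmeticFunction.liouville (2 * N) : ℤ) : ℝ) =
      -((ArithmeticFunction.liouville N : ℤ) : ℝ) := fun N => by
    rw [Literature.NumberTheory.LFunctions.Green2012.liouville_two_mul, Int.cast_neg]
  have hbound : ∀ g : ℕ → ℕ,
      |∑ M ∈ Finset.range J, ((ArithmeticFunction.liouville (g M) : ℤ) : ℝ)| ≤ J := fun g => by
    calc |∑ M ∈ Finset.range J, ((ArithmeticFunction.liouville (g M) : ℤ) : ℝ)|
        ≤ ∑ M ∈ Finset.range J, |((ArithmeticFunction.liouville (g M) : ℤ) : ℝ)| :=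
          Finset.abs_sum_le_sum_abs _ _
      _ ≤ ∑ M ∈ Finset.range J, (1 : ℝ) := Finset.sum_le_sum fun M _ => hfb _
      _ = J := by simp
  have hsplit : ∑ N ∈ Finset.range (4 * J), ((ArithmeticFunction.liouville N : ℤ) : ℝ) =
      -∑ M ∈ Finset.range J, ((ArithmeticFunction.liouville (2 * M) : ℤ) : ℝ) +
        ∑ M ∈ Finset.range J, ((ArithmeticFunction.liouville (2 * (J + M) + 1) : ℤ) : ℝ) := by
    calc ∑ N ∈ Finset.range (4 * J), ((ArithmeticFunction.liouville N : ℤ) : ℝ)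
        = ∑ N ∈ Finset.range (2 * J), (((ArithmeticFunction.liouville (2 * N) : ℤ) : ℝ) +
            ((ArithmeticFunction.liouville (2 * N + 1) : ℤ) : ℝ)) := by
          rw [show 4 * J = 2 * (2 * J) by ring]
          exact sum_range_two_mul _ (2 * J)
      _ = -∑ N ∈ Finset.range (2 * J), ((ArithmeticFunction.liouville N : ℤ) : ℝ) +
            ∑ N ∈ Finset.range (2 * J), ((ArithmeticFunction.liouville (2 * N + 1) : ℤ) : ℝ) := by
          rw [Finset.sum_add_distrib, ← Finset.sum_neg_distrib]
          simp only [h2]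
      _ = -(∑ M ∈ Finset.range J, (((ArithmeticFunction.liouville (2 * M) : ℤ) : ℝ) +
              ((ArithmeticFunction.liouville (2 * M + 1) : ℤ) : ℝ))) +
            (∑ M ∈ Finset.range J, ((ArithmeticFunction.liouville (2 * M + 1) : ℤ) : ℝ) +
              ∑ M ∈ Finset.range J, ((ArithmeticFunction.liouville (2 * (J + M) + 1) : ℤ) : ℝ)) := by
          rw [sum_range_two_mul _ J, show 2 * J = J + J by ring, Finset.sum_range_add]
      _ = _ := by
          rw [Finset.sum_add_distrib]
          ring
  rw [hsplit]
  calc |-∑ M ∈ Finset.range J, ((ArithmeticFunction.liouville (2 * M) : ℤ) : ℝ) +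
        ∑ M ∈ Finset.range J, ((ArithmeticFunction.liouville (2 * (J + M) + 1) : ℤ) : ℝ)|
      ≤ |-∑ M ∈ Finset.range J, ((ArithmeticFunction.liouville (2 * M) : ℤ) : ℝ)| +
        |∑ M ∈ Finset.range J, ((ArithmeticFunction.liouville (2 * (J + M) + 1) : ℤ) : ℝ)| :=
        abs_add_le _ _
    _ ≤ J + J := by
        rw [abs_neg]
        exact add_le_add (hbound fun M => 2 * M) (hbound fun M => 2 * (J + M) + 1)
    _ = 2 * J := by ring

/-! ### The class glue, for an arbitrary basis -/

/-- **Möbius randomness for a constant-depth class excludes the Liouville language from it**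
(basis-generic form of the `LiouvilleNotAC0` / `LiouvilleNotTC0` glue of route MobiusLadder;
Green 2012, §1, set-up of Theorem 1, for the circuit/digit conventions). If, for every depth `d`,
polynomial size bound `p` and `ε > 0`, eventually every circuit over the basis `B` of `acDepth ≤ d`
and size `≤ p(n)` has correlation `|∑_{N<2^n} λ(N)·sgn C(bits N)| ≤ ε 2^n`, then
`L_λ = {bin(N) : λ(N) = -1}` lies in no class `DepthSizeClass B d p`. Proof: a deciding family,
at length `n = k+3`, outputs `[2^(n-1) ≤ N ∧ λ(N) = -1]` on the digits of `N < 2^n`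
(`ofFn_testBit_mem_toLanguage_iff`), so the correlation sum is `2^(n-1) + ∑_{N<2^(n-1)} λ(N)
≥ 2^(n-1) - 2^(n-2)` (`abs_sum_liouville_range_le`), contradicting `ε = 1/8`. [cite: Green2012, §1] -/
theorem liouvilleLang_not_mem_depthSizeClass (B : Set GateFn)
    (H : ∀ d : ℕ, ∀ p : Polynomial ℕ, ∀ ε : ℝ, 0 < ε → ∀ᶠ n : ℕ in Filter.atTop,
      ∀ C : Circuit (Fin n), C.IsOver B → C.acDepth ≤ d → C.size ≤ p.eval n →
        |∑ N ∈ Finset.range (2 ^ n), ((ArithmeticFunction.liouville N : ℤ) : ℝ) *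
            sgn (C.eval (fun i : Fin n => Nat.testBit N i))| ≤ ε * (2 : ℝ) ^ n)
    (d : ℕ) (p : Polynomial ℕ) :
    encodingNatBool.toLanguage {N : ℕ | ArithmeticFunction.liouville N = -1} ∉
      DepthSizeClass B (fun _ => d) (fun n => p.eval n) := by
  rintro ⟨C, hC, hdec⟩
  have hev := H d p (1 / 8) (by norm_num)
  obtain ⟨n, hn3, hn⟩ := ((Filter.eventually_ge_atTop 3).and hev).exists
  obtain ⟨k, rfl⟩ : ∃ k, n = k + 3 := ⟨n - 3, by omega⟩
  have hb := hn (C (k + 3)) (hC _).1 (hC _).2.1 (hC _).2.2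
  have hJ : 0 < 2 ^ k := Nat.two_pow_pos k
  have hpow3 : 2 ^ (k + 3) = 4 * 2 ^ k + 4 * 2 ^ k := by rw [pow_add]; ring
  have hpow2 : 2 ^ (k + 2) = 4 * 2 ^ k := by rw [pow_add]; ring
  -- the deciding circuit, on the digits of `N < 2^(k+3)`, outputs `[2^(k+2) ≤ N ∧ λ N = -1]`
  have heval : ∀ N : ℕ, N < 2 ^ (k + 3) →
      (C (k + 3)).eval (fun i : Fin (k + 3) => Nat.testBit N i) =
        decide (2 ^ (k + 2) ≤ N ∧ ArithmeticFunction.liouville N = -1) := by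
    intro N hN
    rw [hdec.eval_eq]
    have hiff := ofFn_testBit_mem_toLanguage_iff
      {N : ℕ | ArithmeticFunction.liouville N = -1} (k := k + 2) hN
    simp only [Set.mem_setOf_eq] at hiff
    by_cases h : 2 ^ (k + 2) ≤ N ∧ ArithmeticFunction.liouville N = -1
    · rw [decide_eq_true h]
      exact (Set.mem_iff_boolIndicator _ _).1 (hiff.2 h)
    · rw [decide_eq_false h]
      exact (Set.notMem_iff_boolIndicator _ _).1 fun hm => h (hiff.1 hm)
  -- lower half: not codewords, the circuit rejects, the term is `λ(N)`
  have hlow : ∀ N ∈ Finset.range (4 * 2 ^ k),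
      ((ArithmeticFunction.liouville N : ℤ) : ℝ) *
          sgn ((C (k + 3)).eval (fun i : Fin (k + 3) => Nat.testBit N i)) =
        ((ArithmeticFunction.liouville N : ℤ) : ℝ) := by
    intro N hN
    rw [Finset.mem_range] at hN
    rw [heval N (by omega)]
    have hnot : ¬ (2 ^ (k + 2) ≤ N ∧ ArithmeticFunction.liouville N = -1) := fun h => by
      have := h.1
      omega
    rw [decide_eq_false hnot, sgn_false, mul_one]
  -- upper half: codewords, the circuit outputs `[λ N = -1]`, the term is `1`
  have hhigh : ∀ M ∈ Finset.range (4 * 2 ^ k),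
      ((ArithmeticFunction.liouville (4 * 2 ^ k + M) : ℤ) : ℝ) *
          sgn ((C (k + 3)).eval (fun i : Fin (k + 3) => Nat.testBit (4 * 2 ^ k + M) i)) = 1 := by
    intro M hM
    rw [Finset.mem_range] at hM
    rw [heval _ (by omega)]
    have hle : 2 ^ (k + 2) ≤ 4 * 2 ^ k + M := by omega
    have hne : 4 * 2 ^ k + M ≠ 0 := by omega
    rcases liouville_eq_one_or_eq_neg_one hne with h1 | h1
    · have hnot : ¬ (2 ^ (k + 2) ≤ 4 * 2 ^ k + M ∧
          ArithmeticFunction.liouville (4 * 2 ^ k + M) = -1) := by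
        rintro ⟨-, h⟩
        rw [h1] at h
        norm_num at h
      rw [decide_eq_false hnot, sgn_false, h1]
      simp
    · rw [decide_eq_true ⟨hle, h1⟩, sgn_true, h1]
      simp
  have hsum : ∑ N ∈ Finset.range (2 ^ (k + 3)), ((ArithmeticFunction.liouville N : ℤ) : ℝ) *
        sgn ((C (k + 3)).eval (fun i : Fin (k + 3) => Nat.testBit N i)) =
      ∑ N ∈ Finset.range (4 * 2 ^ k), ((ArithmeticFunction.liouville N : ℤ) : ℝ) + 4 * 2 ^ k := by
    rw [hpow3, Finset.sum_range_add, Finset.sum_congr rfl hlow, Finset.sum_congr rfl hhigh]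
    simp
  have hT := abs_sum_liouville_range_le (2 ^ k)
  rw [hsum] at hb
  have h8 : (1 / 8 : ℝ) * (2 : ℝ) ^ (k + 3) = (2 : ℝ) ^ k := by
    rw [pow_add]
    ring
  rw [h8] at hb
  have hpos : (0 : ℝ) < (2 : ℝ) ^ k := by positivity
  have h1 := (abs_le.1 hb).2
  have h2 := (abs_le.1 hT).1
  push_cast at h1 h2
  linarith

/-- Settles `stmt-QuantumAdvantage-1398` (route MobiusLadder, support `LiouvilleNotTC0`): Möbius
randomness for TC⁰ (`LiouvilleOrthogonalTC0`) implies that the Liouville language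
`{bin(N) : λ(N) = -1}` is not in `TC0` — the basis-generic glue
`liouvilleLang_not_mem_depthSizeClass` at `tcBasis` (Arora–Barak 2009, §14.4.2 for the class).
[cite: AroraBarakCC2009, §14.4.2] -/
theorem LiouvilleNotTC0_proof :
    Summit.QuantumAdvantage.QuantumAdvantage.Theses.MobiusLadder.LiouvilleNotTC0 := by
  unfold Summit.QuantumAdvantage.QuantumAdvantage.Theses.MobiusLadder.LiouvilleNotTC0
    Summit.QuantumAdvantage.QuantumAdvantage.Theses.MobiusLadder.LiouvilleOrthogonalTC0
  intro H hL
  obtain ⟨d, p, hmem⟩ := hL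
  exact liouvilleLang_not_mem_depthSizeClass tcBasis H d p hmem

end Summit.QuantumAdvantage.QuantumAdvantage.Theorems.MobiusLadder
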